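import Literature.NumberTheory.LFunctions.WeilExplicitFormulaProofs
import Literature.NumberTheory.LFunctions.WeilExplicitProofs
import Literature.NumberTheory.LFunctions.WeilMellinPolyDecay
import Literature.NumberTheory.LFunctions.WeilThetaPhiMellin
import HarnessLib

/-!
# The theta null identity `W(g ⋆ H̃_b) → 0` (crux OddBartaFloor, line Sketch, stub thetaNull)

`Φ′ = weilThetaPhiDeriv` is a global null vector of Weil's form: `(Φ′)^(s) = −(s − ½)ξ(s)` vanishes
at every nontrivial zero of `ζ`, on or off the critical line
(`weilMellin_weilThetaPhiDeriv_eq_zero_of_riemannZeta_eq_zero`). The tree's explicit formula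
(`explicit_formula_holds`, Bombieri 2000 Thm. 2) is for compactly supported tests, so we use the
truncations `H_b = weilOddThetaVector b = 𝟙_{[−b,b]}·(−Φ′)`. For a Weil test `g`:

* `H̃_b = 𝟙_{[−b,b]}·Φ′` (`H_b` is real and odd), a bounded measurable compactly supported function,
  so `k_b := g ⋆ H̃_b` is a Weil test (`HasCompactSupport.contDiff_convolution_left`);
* `W(k_b) = Σ_ρ m(ρ) k̂_b(ρ)` with an absolutely convergent zero side (`explicit_formula_holds`,
  `hasWeilZeroSide_tsum`, `summable_norm_zeroSide`);
* `k̂_b(ρ) = ĝ(ρ)·(H̃_b)^(ρ)` (Fubini, as in `weilMellin_weilConv_holds`), and at a nontrivial zero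
  `(H̃_b)^(ρ) = (Φ′)^(ρ) − ∫_{|t|>b} Φ′(t)e^{(ρ−½)t} dt = −∫_{|t|>b} Φ′(t)e^{(ρ−½)t} dt` has modulus at
  most `τ_b := ∫_{|t|>b} |Φ′(t)| e^{|t|/2} dt`, uniformly in `ρ` (`0 < Re ρ < 1`);
* `|ĝ(ρ)| ≤ D/(1+γ²)²` in the strip (`norm_weilMellin_le_pow_of_abs_re_le`) and
  `Σ_ρ m(ρ)/(1+γ²)² < ∞` (`weilZeroSummable`).

Hence `‖W(k_b)‖ ≤ τ_b · D · Σ_ρ m(ρ)/(1+γ²)²`, and `τ_b → 0` because `|Φ′(t)|e^{|t|/2}` is integrable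
(super-exponential decay `abs_weilThetaPhiDeriv_le`). Sources: E. Bombieri, Rend. Lincei (9) 11
(2000), §2 Thm. 2 (explicit formula) and §3 (the transform of a convolution); E. C. Titchmarsh,
*The Theory of the Riemann Zeta-Function* (1986), §10.1 (Riemann's kernel `Φ`).
-/

set_option linter.dupNamespace false

noncomputable section

open Set MeasureTheory Filter Complex
open scoped Real Topology ComplexConjugate ArithmeticFunction.vonMangoldt ENNReal
open scoped Convolution

namespace Summit.RiemannHypothesis.RiemannHypothesis.Theorems.OddBartaFloor

open Literature.NumberTheory.LFunctions

/-- `H̃_b = 𝟙_{[−b,b]}·Φ′`: the Weil reflection of the (real, odd) odd theta vector `H_b`. [folklore] -/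
private theorem thetaNull_reflect (b : ℝ) :
    weilReflect (fun t => ((weilOddThetaVector b t : ℝ) : ℂ)) =
      (Icc (-b) b).indicator fun t => (weilThetaPhiDeriv t : ℂ) := by
  funext t
  simp only [weilReflect, Complex.conj_ofReal, weilOddThetaVector_neg]
  by_cases ht : t ∈ Icc (-b) b
  · rw [weilOddThetaVector_of_mem ht, indicator_of_mem ht, neg_neg]
  · rw [weilOddThetaVector_of_not_mem ht, indicator_of_notMem ht, neg_zero, Complex.ofReal_zero]

/-- `(g ⋆ P)^(s) = ĝ(s)·P̂(s)` for `g` continuous of compact support and a second factor `P` with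
`P(u)e^{(s−½)u}` integrable: `(g ⋆ P)(t)e^{ct} = ((g e^{c·}) ⋆ (P e^{c·}))(t)` and
`∫ (G ⋆ H) = (∫ G)(∫ H)` (`MeasureTheory.integral_convolution`; Bombieri 2000 §3). [folklore] -/
private theorem thetaNull_mellin_conv {g P : ℝ → ℂ} (hg : Continuous g)
    (hg' : HasCompactSupport g) (s : ℂ)
    (hHi : Integrable fun u : ℝ => P u * cexp ((s - 1 / 2) * u)) :
    weilMellin (weilConv g P) s = weilMellin g s * weilMellin P s := by
  -- adapted from `weilMellin_weilConv_holds` (Literature/…/WeilExplicitProofs.lean)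
  set c : ℂ := s - 1 / 2 with hc
  set G : ℝ → ℂ := fun u ↦ g u * cexp (c * u) with hG
  set H : ℝ → ℂ := fun u ↦ P u * cexp (c * u) with hH
  have hGi : Integrable G :=
    (hg.mul (by fun_prop)).integrable_of_hasCompactSupport hg'.mul_right
  have key : ∀ t : ℝ, weilConv g P t * cexp (c * t) = (G ⋆[ContinuousLinearMap.mul ℂ ℂ] H) t := by
    intro t
    rw [weilConv_apply, convolution_def, ← integral_mul_const]
    congr 1 with u
    simp only [hG, hH, ContinuousLinearMap.mul_apply']
    have he : cexp (c * t) = cexp (c * u) * cexp (c * ((t - u : ℝ) : ℂ)) := by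
      rw [← Complex.exp_add]
      push_cast
      ring_nf
    rw [he]
    ring
  have hL : weilMellin (weilConv g P) s = ∫ t : ℝ, (G ⋆[ContinuousLinearMap.mul ℂ ℂ] H) t := by
    unfold weilMellin
    exact integral_congr_ae (Eventually.of_forall fun t ↦ key t)
  rw [hL, integral_convolution (ContinuousLinearMap.mul ℂ ℂ) hGi hHi,
    ContinuousLinearMap.mul_apply']
  rfl

/-- The majorant `t ↦ |Φ′(t)| e^{|t|/2}` is integrable on `ℝ` (super-exponential decay of `Φ′`,
`abs_weilThetaPhiDeriv_le`). [folklore] -/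
private theorem thetaNull_integrable_majorant :
    Integrable fun t : ℝ => |weilThetaPhiDeriv t| * rexp (|t| / 2) := by
  have h := integrable_mul_cexp_of_abs_le (f := fun t => |weilThetaPhiDeriv t| * rexp (|t| / 2))
    (by fun_prop) (by positivity : (0 : ℝ) < π / 2) (C := 5088) (c := 1) (fun t => ?_) 0
  · refine h.norm.congr (Eventually.of_forall fun t => ?_)
    simp only [zero_mul, Complex.exp_zero, mul_one, Complex.norm_real, Real.norm_eq_abs]
    exact abs_of_nonneg (by positivity)
  · rw [abs_of_nonneg (by positivity)]
    calc |weilThetaPhiDeriv t| * rexp (|t| / 2)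
        ≤ 5088 * rexp (1 / 2 * |t| - π / 2 * rexp (2 * |t|)) * rexp (|t| / 2) := by
          gcongr
          exact abs_weilThetaPhiDeriv_le t
      _ = 5088 * rexp (1 * |t| - π / 2 * rexp (2 * |t|)) := by
          rw [mul_assoc, ← Real.exp_add]
          congr 2
          ring

/-- **The theta null identity.** For every Weil test `g`, `W(g ⋆ H̃_b) → 0` as `b → ∞`, where
`H_b = weilOddThetaVector b = 𝟙_{[−b,b]}·(−Φ′)` is the truncated odd theta vector: by the explicit
formula `W(g ⋆ H̃_b) = Σ_ρ m(ρ) ĝ(ρ) (H̃_b)^(ρ)`, and `(H̃_b)^(ρ) = −∫_{|t|>b} Φ′(t)e^{(ρ−½)t} dt → 0`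
uniformly on the nontrivial zeros because `(Φ′)^(ρ) = −(ρ − ½)ξ(ρ) = 0` there (Bombieri 2000, §2
Thm. 2 and §3; Titchmarsh §10.1). [cite: Bombieri2000Weil, §2 Thm. 2] -/
theorem stub_thetaNull :
    ∀ g : ℝ → ℂ, IsWeilTest g →
      Tendsto (fun b : ℝ => weilFunctional (weilConv g (weilReflect fun t => ((weilOddThetaVector b t : ℝ) : ℂ))))
        atTop (𝓝 0) := by
  intro g hg
  obtain ⟨D, hD0, hD⟩ := norm_weilMellin_le_pow_of_abs_re_le hg (1 / 2) 2
  set Z : ℝ := ∑' ρ : ZetaZeros.riemannZetaNontrivialZeros, weilZeroWeight (ρ : ℂ) with hZ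
  set F : ℝ → ℝ := fun t => |weilThetaPhiDeriv t| * rexp (|t| / 2) with hF
  set τ : ℝ → ℝ := fun b => ∫ t in (Icc (-b) b)ᶜ, F t with hτ
  -- the tails of the integrable majorant tend to `0`
  have hτ0 : Tendsto τ atTop (𝓝 0) := by
    have h := tendsto_setIntegral_of_antitone (μ := volume) (f := F)
      (s := fun b : ℝ => (Icc (-b) b)ᶜ) (fun b => measurableSet_Icc.compl)
      (fun b₁ b₂ h => compl_subset_compl.2 (Icc_subset_Icc (neg_le_neg h) h))
      ⟨0, thetaNull_integrable_majorant.integrableOn⟩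
    have he : ⋂ b : ℝ, (Icc (-b) b)ᶜ = ∅ :=
      eq_empty_of_forall_notMem fun x hx => (mem_iInter.1 hx |x|) ⟨neg_abs_le x, le_abs_self x⟩
    rwa [he, setIntegral_empty] at h
  -- the bound `‖W(g ⋆ H̃_b)‖ ≤ τ_b · D · Z`
  have hbd : ∀ b : ℝ, ‖weilFunctional (weilConv g
      (weilReflect fun t => ((weilOddThetaVector b t : ℝ) : ℂ)))‖ ≤ τ b * D * Z := by
    intro b
    rw [thetaNull_reflect]
    set P : ℝ → ℂ := (Icc (-b) b).indicator fun t => (weilThetaPhiDeriv t : ℂ) with hP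
    have hPi : ∀ c : ℂ, Integrable fun u : ℝ => P u * cexp (c * u) := fun c =>
      ((integrable_weilThetaPhiDeriv_mul_cexp c).indicator measurableSet_Icc).congr
        (Eventually.of_forall fun u => indicator_mul_left _ _ _)
    have hP1 : Integrable P := by simpa using hPi 0
    have hPc : HasCompactSupport P :=
      HasCompactSupport.intro isCompact_Icc fun t ht => indicator_of_notMem ht _
    -- `g ⋆ H̃_b` is a Weil test, so the explicit formula applies, with absolutely convergent zero side
    have hk : IsWeilTest (weilConv g P) := by
      rw [weilConv_eq_convolution_real]
      exact ⟨hg.2.contDiff_convolution_left (ContinuousLinearMap.mul ℝ ℂ) hg.1 hP1.locallyIntegrable,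
        HasCompactSupport.convolution (L := ContinuousLinearMap.mul ℝ ℂ) hg.2 hPc⟩
    have hsum := summable_norm_zeroSide hk
    have hW : weilFunctional (weilConv g P) = ∑' ρ : ZetaZeros.riemannZetaNontrivialZeros,
        (riemannZetaZeroOrder (ρ : ℂ) : ℂ) * weilMellin (weilConv g P) ρ :=
      tendsto_nhds_unique (explicit_formula_holds hk) (hasWeilZeroSide_tsum hsum)
    -- the window transform at a nontrivial zero: `‖(H̃_b)^(ρ)‖ ≤ τ_b`
    have hPρ : ∀ ρ ∈ ZetaZeros.riemannZetaNontrivialZeros, ‖weilMellin P ρ‖ ≤ τ b := by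
      intro ρ hρ
      have h0 := ZetaZeros.riemannZetaNontrivialZeros.re_pos hρ
      have h1 := ZetaZeros.riemannZetaNontrivialZeros.re_lt_one hρ
      have hI := integrable_weilThetaPhiDeriv_mul_cexp (ρ - 1 / 2)
      have hM : weilMellin P ρ =
          ∫ t in Icc (-b) b, (weilThetaPhiDeriv t : ℂ) * cexp ((ρ - 1 / 2) * t) := by
        rw [weilMellin, ← integral_indicator measurableSet_Icc]
        refine integral_congr_ae (Eventually.of_forall fun u => ?_)
        rw [hP, indicator_mul_left]
      have hz : (∫ t in Icc (-b) b, (weilThetaPhiDeriv t : ℂ) * cexp ((ρ - 1 / 2) * t)) +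
          ∫ t in (Icc (-b) b)ᶜ, (weilThetaPhiDeriv t : ℂ) * cexp ((ρ - 1 / 2) * t) = 0 := by
        rw [integral_add_compl measurableSet_Icc hI]
        exact weilMellin_weilThetaPhiDeriv_eq_zero_of_riemannZeta_eq_zero
          (ZetaZeros.riemannZetaNontrivialZeros.zeta_eq_zero hρ) h0 h1
      rw [hM, eq_neg_of_add_eq_zero_left hz, norm_neg]
      refine norm_integral_le_of_norm_le thetaNull_integrable_majorant.integrableOn
        (Eventually.of_forall fun t => ?_)
      rw [norm_mul, Complex.norm_real, Complex.norm_exp, Real.norm_eq_abs]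
      refine mul_le_mul_of_nonneg_left (Real.exp_le_exp.2 ?_) (abs_nonneg _)
      have hre : ((ρ - 1 / 2) * (t : ℂ)).re = (ρ.re - 1 / 2) * t := by simp [sub_re, mul_re]
      rw [hre]
      calc (ρ.re - 1 / 2) * t ≤ |(ρ.re - 1 / 2) * t| := le_abs_self _
        _ = |ρ.re - 1 / 2| * |t| := abs_mul _ _
        _ ≤ 1 / 2 * |t| := by gcongr; exact abs_le.2 ⟨by linarith, by linarith⟩
        _ = |t| / 2 := by ring
    -- termwise: `‖m(ρ) k̂_b(ρ)‖ ≤ τ_b · D · m(ρ)/(1+γ²)²`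
    have hterm : ∀ ρ : ZetaZeros.riemannZetaNontrivialZeros,
        ‖(riemannZetaZeroOrder (ρ : ℂ) : ℂ) * weilMellin (weilConv g P) ρ‖ ≤
          τ b * D * weilZeroWeight (ρ : ℂ) := by
      intro ρ
      have hρ := ρ.2
      have h0 := ZetaZeros.riemannZetaNontrivialZeros.re_pos hρ
      have h1 := ZetaZeros.riemannZetaNontrivialZeros.re_lt_one hρ
      have hm : (0 : ℝ) ≤ riemannZetaZeroOrder (ρ : ℂ) := by
        exact_mod_cast riemannZetaZeroOrder_nonneg (ZetaZeros.riemannZetaNontrivialZeros.ne_one hρ)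
      have hgρ : ‖weilMellin g ρ‖ ≤ D / (1 + (ρ : ℂ).im ^ 2) ^ 2 :=
        hD ρ (abs_le.2 ⟨by linarith, by linarith⟩)
      rw [thetaNull_mellin_conv hg.1.continuous hg.2 ρ (hPi _), norm_mul, norm_mul,
        Complex.norm_intCast, abs_of_nonneg hm, weilZeroWeight]
      calc (riemannZetaZeroOrder (ρ : ℂ) : ℝ) * (‖weilMellin g ρ‖ * ‖weilMellin P ρ‖)
          ≤ (riemannZetaZeroOrder (ρ : ℂ) : ℝ) * (D / (1 + (ρ : ℂ).im ^ 2) ^ 2 * τ b) :=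
            mul_le_mul_of_nonneg_left
              (mul_le_mul hgρ (hPρ ρ hρ) (norm_nonneg _) (by positivity)) hm
        _ = τ b * D * ((riemannZetaZeroOrder (ρ : ℂ) : ℝ) / (1 + (ρ : ℂ).im ^ 2) ^ 2) := by ring
    rw [hW]
    calc ‖∑' ρ : ZetaZeros.riemannZetaNontrivialZeros,
          (riemannZetaZeroOrder (ρ : ℂ) : ℂ) * weilMellin (weilConv g P) ρ‖
        ≤ ∑' ρ : ZetaZeros.riemannZetaNontrivialZeros,
            ‖(riemannZetaZeroOrder (ρ : ℂ) : ℂ) * weilMellin (weilConv g P) ρ‖ :=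
          norm_tsum_le_tsum_norm hsum
      _ ≤ ∑' ρ : ZetaZeros.riemannZetaNontrivialZeros, τ b * D * weilZeroWeight (ρ : ℂ) :=
          hsum.tsum_le_tsum hterm (weilZeroSummable.mul_left _)
      _ = τ b * D * Z := tsum_mul_left
  refine squeeze_zero_norm hbd ?_
  simpa using (hτ0.mul_const D).mul_const Z

end Summit.RiemannHypothesis.RiemannHypothesis.Theorems.OddBartaFloor

end
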